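import Summits.ResolutionOfSingularities.ResolutionOfSingularities.Theorems.WeightedInvariantIotaOrder
import Literature.AlgebraicGeometry.Resolution.RegularLocalRingsUFD
import Literature.AlgebraicGeometry.Resolution.RegularLocalRingsProofs
import HarnessLib

/-!
# The (strat) clause of the canonical game for the ORDER FUNCTION `iotaOrd` at positions of Krull dimension ≤ 2
# — door `HypersurfaceCentreConstruction` (stmt-ResolutionOfSingularities-19897), route `WeightedInvariant`

[OURS · L1 W4.3 · cell `res-hironaka`, HUMAN RULING D-0089] Helper file `--supports stmt-ResolutionOfSingularities-19897`,
own-thread after-care of `Theorems/WeightedInvariantIotaOrderNotCanonical.lean` (p506015: the (strat) sub-clause of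
`CanonicalGameClause p iotaOrd J` FAILS at the dimension-3 position `(k[x,y,z]_(x,y,z), z² + x³y³)`), making kernel the
parenthetical of res-L1-w43-plan-1's `CRUX-PLAN.md` §v7.2, RUNG P2 (2026-08-27T07:01Z): «ι₂ := iotaOrd (admissible here:
(strat) HOLDS for the order function at dim-2 positions — if ord_𝔭 f = ord_𝔪 f = ν at a height-1 prime 𝔭 = (g) then
f = unit·g^ν with g a regular parameter (UFD + order valuation), so the top stratum is V(g) regular, else {𝔪})».
Typer res-type-073 (gen 10). AI-produced, weaker than expert review. NOT a statement of the manuscript under review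
(Hironaka 2017, [claim: Hironaka2017, status: under-review]); nothing here is attributed to its author; nothing here is a
claim about resolution of singularities. The ι-half only: the centre filtration `J₂` of the reserved ORDER (o24) is not
touched.

## What is proved (no definitions; `S` is ANY regular local ring — no ground field, no e.f.t. hypothesis, every characteristic)

Recall the (strat) conjunct of `CanonicalGameClause` (`Theorems/WeightedInvariantHypersurfaceLocalGameEFT3.lean`): a prime
`P ∋ f` with `S ⧸ P` regular such that for every prime `𝔭 ∋ f`, `ι (S_𝔭) f = ι S f ↔ P ≤ 𝔭`.

* `exists_eq_unit_mul_pow_of_iotaOrd_localization_eq` (the core): if `ringKrullDim S ≤ 2`, `0 ≠ f ∈ 𝔭` for a prime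
  `𝔭 ≠ 𝔪` and `ord_{S_𝔭}(f) = ord_𝔪(f)`, then `f = v·gⁿ` with `v` a unit, `g ∈ 𝔪 ∖ 𝔪²`, `n ≥ 1`, and `𝔭 = (g)`.
  Proof: `S` is a UFD (Matsumura 20.3, tree `IsRegularLocalRing.uniqueFactorizationMonoid`) and `𝔭` has height one
  (`0 < ht 𝔭 < ht 𝔪 = dim S ≤ 2`), so `𝔭 = (q)` for a prime element `q` (Mathlib `Ideal.eq_span_singleton_of_height_eq_one`);
  write `f = qᵐ·h` with `q ∤ h`; in the regular local ring `S_𝔭` (Matsumura 19.3, tree) the order is additive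
  (Zariski–Samuel VIII §1, tree `adicOrder_mul`), `ord(q/1) = 1` and `h/1` is a unit, so `ord_{S_𝔭} f = m`; in `S`,
  `ord f = m·ord q + ord h`; equality forces `ord q = 1`, `ord h = 0`.
* `strat_of_eq_unit_mul_pow` — CASE A, EVERY Krull dimension: for `f = v·gⁿ` (`v` unit, `g ∈ 𝔪 ∖ 𝔪²`, `n ≥ 1`) the prime
  `P = (g)` satisfies (strat) for `iotaOrd`: `(g)` is prime and `S ⧸ (g)` regular (Matsumura 14.2, tree
  `quotient_span_singleton`), and at every prime `𝔭 ∋ f` BOTH sides of the iff hold (`g ∈ 𝔭`;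
  `n ≤ ord_{S_𝔭} f ≤ ord_𝔪 f = n` by (c7) `iotaOrd_generizationMonotone`, p502169).
* `strat_maximalIdeal_of_forall_ne` — CASE B, Krull dimension `≤ 2`: if `f` is of no such form, `P = 𝔪` satisfies (strat).
* `strat_iotaOrd_of_ringKrullDim_le_two` — ASSEMBLY: at every regular local ring of Krull dimension `≤ 2` and every
  `0 ≠ f ∈ 𝔪` the (strat) conjunct of `CanonicalGameClause` holds VERBATIM for `ι = iotaOrd`. Sharp in the dimension:
  p506015 `StratSpecimen.not_strat` (dimension 3).
* `strat_prime_unique` — for ANY class function `ι` and any commutative ring: two primes satisfying (strat) for the same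
  `(ι, S, f)` coincide (so a `J`-typer may identify the centre with `(g)` resp. `𝔪`); `strat_prime_eq_span_singleton` /
  `strat_prime_eq_maximalIdeal` — the identification in cases A / B.
* `two_le_of_eq_unit_mul_pow_of_mem_sq`, `adm_span_singleton`, `adm_maximalIdeal` — the matching (adm) conjuncts
  (`f ∈ 𝔪_{S_Q}²` at every prime `Q` over the centre) for the two centres.

## References

* H. Matsumura, *Commutative Ring Theory*, CUP 1986, Thm. 14.2 (quotient by a regular parameter), Thm. 19.3 (Serre:
  localizations of regular local rings), Thm. 20.3 (Auslander–Buchsbaum: regular local rings are factorial) — all via the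
  tree files `RegularLocalRingsProofs.lean` / `RegularLocalRingsUFD.lean`. [Matsumura1987]
* O. Zariski, P. Samuel, *Commutative Algebra* II, Ch. VIII §1 Thm. 1 (the order function of a regular local ring is a
  valuation), via the tree file `RegularLocalOrderValuation.lean`. [ZariskiSamuel1960]
* res-L1-w43-plan-1, `L/res-L1-w43-plan-1/CRUX-PLAN.md` §v7.2 (RUNG P2 design; OURS, AI planning).
-/

noncomputable section

set_option linter.dupNamespace false -- mandated namespace `Summit.<Summit>.<Problem>` of this single-conjunct summit

open IsLocalRing Literature.AlgebraicGeometry.Resolution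

namespace Summit.ResolutionOfSingularities.ResolutionOfSingularities.Cruxes.HypersurfaceCentreConstruction.LocalEngine

namespace IotaOrderStrat

variable {S : Type} [CommRing S]

/-! ## Two order computations -/

/-- `f ∈ 𝔭ⁿ ⇒ n ≤ ord_{S_𝔭}(f)` (`𝔭ⁿ S_𝔭 = 𝔪_{S_𝔭}ⁿ`). [folklore] -/
theorem natCast_le_iotaOrd_localization_of_mem_pow (𝔭 : Ideal S) [𝔭.IsPrime] {f : S} {n : ℕ}
    (h : f ∈ 𝔭 ^ n) :
    (n : Ordinal) ≤ iotaOrd (Localization.AtPrime 𝔭) (algebraMap S (Localization.AtPrime 𝔭) f) := by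
  rw [natCast_le_iotaOrd_iff, ← Localization.AtPrime.map_eq_maximalIdeal, ← Ideal.map_pow]
  exact Ideal.mem_map_of_mem _ h

/-- A regular parameter has order one: `g ∈ 𝔪 ∖ 𝔪² ⇒ ord g = 1`. [folklore] -/
theorem adicOrder_eq_one_of_not_mem_sq [IsLocalRing S] {g : S} (hg : g ∈ maximalIdeal S)
    (hg2 : g ∉ maximalIdeal S ^ 2) : adicOrder g = 1 := by
  have h1 : adicOrder g ≤ (1 : ℕ) := (adicOrder_le_iff g 1).mpr hg2
  have h2 : ((1 : ℕ) : ℕ∞) ≤ adicOrder g := (le_adicOrder_iff g 1).mpr (by rwa [pow_one])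
  exact le_antisymm (by exact_mod_cast h1) (by exact_mod_cast h2)

/-- In a regular local ring `ord(v·gⁿ) = n` for a unit `v` and a regular parameter `g ∈ 𝔪 ∖ 𝔪²` (the order is a
valuation, Zariski–Samuel VIII §1). [cite: ZariskiSamuel1960, Ch. VIII §1 Thm. 1] -/
theorem iotaOrd_unit_mul_pow [IsRegularLocalRing S] {v g : S} (hv : IsUnit v) (hg : g ∈ maximalIdeal S)
    (hg2 : g ∉ maximalIdeal S ^ 2) (n : ℕ) : iotaOrd S (v * g ^ n) = n := by
  rw [iotaOrd_eq_ordOfENat_adicOrder, ← ordOfENat_natCast, ordOfENat_inj, adicOrder_mul, adicOrder_pow,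
    adicOrder_of_isUnit hv, adicOrder_eq_one_of_not_mem_sq hg hg2, zero_add, mul_one]

/-- At the closed point nothing changes: `S → S_𝔪` is an isomorphism for a local ring `S` (the complement of `𝔪`
consists of units), so `iotaOrd (S_𝔪) f = iotaOrd S f` by (c6) `iotaOrd_isoInvariant`. (The `iotaOrd` instance of
res-type-005's `LocalGameEFT4SDimOne.iota_localization_maximalIdeal_eq`, restated here to keep this file's imports to
built modules.) [folklore] -/
theorem iotaOrd_localization_maximalIdeal_eq [IsLocalRing S] (f : S) :
    iotaOrd (Localization.AtPrime (maximalIdeal S)) (algebraMap S (Localization.AtPrime (maximalIdeal S)) f) =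
      iotaOrd S f := by
  have hunits : (maximalIdeal S).primeCompl ≤ IsUnit.submonoid S := by
    intro x hx
    rw [IsUnit.mem_submonoid_iff]
    by_contra hnu
    exact hx ((IsLocalRing.mem_maximalIdeal x).mpr (mem_nonunits_iff.mpr hnu))
  let e : S ≃ₐ[S] Localization.AtPrime (maximalIdeal S) :=
    IsLocalization.atUnits S (maximalIdeal S).primeCompl hunits
  have he : e f = algebraMap S (Localization.AtPrime (maximalIdeal S)) f := by
    simpa using e.commutes f
  rw [← he]
  exact iotaOrd_isoInvariant S (Localization.AtPrime (maximalIdeal S)) e.toRingEquiv f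

/-- If `f = v·gⁿ ∈ 𝔪²` with `v` a unit and `g ∉ 𝔪²` then `2 ≤ n`. [folklore] -/
theorem two_le_of_eq_unit_mul_pow_of_mem_sq [IsRegularLocalRing S] {v g f : S} (hv : IsUnit v)
    (hg : g ∈ maximalIdeal S) (hg2 : g ∉ maximalIdeal S ^ 2) {n : ℕ} (hf : f = v * g ^ n)
    (hf2 : f ∈ maximalIdeal S ^ 2) : 2 ≤ n := by
  have h := (natCast_le_iotaOrd_iff S f 2).mpr hf2
  rw [hf, iotaOrd_unit_mul_pow hv hg hg2 n] at h
  exact_mod_cast h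

/-! ## Uniqueness of the (strat) prime (any `ι`, any ring) -/

/-- **The (strat) prime is unique**: if two primes `P, P' ∋ f` both satisfy the (strat) conjunct of `CanonicalGameClause`
for the same class function `ι` at `(S, f)` — `ι (S_𝔭) f = ι S f ↔ P ≤ 𝔭` for every prime `𝔭 ∋ f` — then `P = P'`
(evaluate each iff at the other prime). [OURS · L1 W4.3, kernel] -/
theorem strat_prime_unique (ι : (R : Type) → [CommRing R] → R → Ordinal.{0}) {f : S} {P P' : Ideal S}
    [P.IsPrime] [P'.IsPrime] (hfP : f ∈ P) (hfP' : f ∈ P')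
    (h : ∀ (𝔭 : Ideal S) [𝔭.IsPrime], f ∈ 𝔭 →
      (ι (Localization.AtPrime 𝔭) (algebraMap S (Localization.AtPrime 𝔭) f) = ι S f ↔ P ≤ 𝔭))
    (h' : ∀ (𝔭 : Ideal S) [𝔭.IsPrime], f ∈ 𝔭 →
      (ι (Localization.AtPrime 𝔭) (algebraMap S (Localization.AtPrime 𝔭) f) = ι S f ↔ P' ≤ 𝔭)) :
    P = P' :=
  le_antisymm ((h P' hfP').mp ((h' P' hfP').mpr le_rfl)) ((h' P hfP).mp ((h P hfP).mpr le_rfl))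

/-! ## CASE A (every Krull dimension): pure powers of a regular parameter, centre `(g)` -/

/-- **CASE A of (strat) for the order function, in EVERY Krull dimension.** Let `S` be a regular local ring and
`f = v·gⁿ` with `v` a unit, `g ∈ 𝔪 ∖ 𝔪²` and `n ≥ 1`. Then `P = (g)` is a prime with `S ⧸ (g)` regular (Matsumura 14.2),
`f ∈ (g)`, and for every prime `𝔭 ∋ f`: `iotaOrd (S_𝔭) f = iotaOrd S f ↔ (g) ≤ 𝔭` — indeed both sides hold, since
`g ∈ 𝔭` and `n ≤ ord_{S_𝔭} f ≤ ord_𝔪 f = n` ((c7) for `iotaOrd`, p502169). [OURS · L1 W4.3, kernel] -/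
theorem strat_of_eq_unit_mul_pow [IsRegularLocalRing S] {v g : S} (hv : IsUnit v) (hg : g ∈ maximalIdeal S)
    (hg2 : g ∉ maximalIdeal S ^ 2) {n : ℕ} (hn : 0 < n) {f : S} (hf : f = v * g ^ n) :
    (Ideal.span {g}).IsPrime ∧ IsRegularLocalRing (S ⧸ Ideal.span {g}) ∧ f ∈ Ideal.span {g} ∧
      ∀ (𝔭 : Ideal S) [𝔭.IsPrime], f ∈ 𝔭 →
        (iotaOrd (Localization.AtPrime 𝔭) (algebraMap S (Localization.AtPrime 𝔭) f) = iotaOrd S f ↔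
          Ideal.span {g} ≤ 𝔭) := by
  have hreg : IsRegularLocalRing (S ⧸ Ideal.span {g}) := (quotient_span_singleton S hg hg2).1
  have hprime : (Ideal.span {g}).IsPrime := by
    haveI := isDomain_of_isRegularLocalRing (S ⧸ Ideal.span {g})
    exact (Ideal.Quotient.isDomain_iff_prime _).mp ‹_›
  have hfg : f ∈ Ideal.span {g} := by
    rw [hf]
    exact Ideal.mul_mem_left _ _ (Ideal.pow_mem_of_mem _ (Ideal.mem_span_singleton_self g) _ hn)
  have hordf : iotaOrd S f = n := by rw [hf, iotaOrd_unit_mul_pow hv hg hg2 n]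
  refine ⟨hprime, hreg, hfg, fun 𝔭 _ hf𝔭 => ?_⟩
  have hg𝔭 : g ∈ 𝔭 := by
    rw [hf] at hf𝔭
    exact Ideal.IsPrime.mem_of_pow_mem ‹_› n ((Ideal.unit_mul_mem_iff_mem 𝔭 hv).mp hf𝔭)
  have hle : Ideal.span {g} ≤ 𝔭 := (Ideal.span_singleton_le_iff_mem _).mpr hg𝔭
  refine ⟨fun _ => hle, fun _ => le_antisymm (iotaOrd_generizationMonotone S 𝔭 f) ?_⟩
  rw [hordf]
  refine natCast_le_iotaOrd_localization_of_mem_pow 𝔭 ?_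
  rw [hf]
  exact Ideal.mul_mem_left _ _ (Ideal.pow_mem_pow hg𝔭 n)

/-- In case A the (strat) prime IS `(g)`: any prime `P ∋ f` satisfying (strat) for `iotaOrd` at `f = v·gⁿ` equals `(g)`.
[OURS · L1 W4.3, kernel] -/
theorem strat_prime_eq_span_singleton [IsRegularLocalRing S] {v g : S} (hv : IsUnit v)
    (hg : g ∈ maximalIdeal S) (hg2 : g ∉ maximalIdeal S ^ 2) {n : ℕ} (hn : 0 < n) {f : S} (hf : f = v * g ^ n)
    {P : Ideal S} [P.IsPrime] (hfP : f ∈ P)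
    (h : ∀ (𝔭 : Ideal S) [𝔭.IsPrime], f ∈ 𝔭 →
      (iotaOrd (Localization.AtPrime 𝔭) (algebraMap S (Localization.AtPrime 𝔭) f) = iotaOrd S f ↔ P ≤ 𝔭)) :
    P = Ideal.span {g} := by
  obtain ⟨hprime, -, hfg, hstrat⟩ := strat_of_eq_unit_mul_pow hv hg hg2 hn hf
  haveI := hprime
  exact strat_prime_unique iotaOrd hfP hfg h hstrat

/-- (adm) for the centre `(g)` of case A: if `f = v·gⁿ` with `n ≥ 2` then `f ∈ 𝔪_{S_Q}²` at every prime `Q ⊇ (g)`.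
[folklore] -/
theorem adm_span_singleton {v g f : S} {n : ℕ} (hn : 2 ≤ n) (hf : f = v * g ^ n) (Q : Ideal S) [Q.IsPrime]
    (hQ : Ideal.span {g} ≤ Q) :
    algebraMap S (Localization.AtPrime Q) f ∈ maximalIdeal (Localization.AtPrime Q) ^ 2 := by
  have hgQ : g ∈ Q := hQ (Ideal.mem_span_singleton_self g)
  have hfQ : f ∈ Q ^ 2 := by
    rw [hf]
    exact Ideal.mul_mem_left _ _ (Ideal.pow_le_pow_right hn (Ideal.pow_mem_pow hgQ n))
  have := Ideal.mem_map_of_mem (algebraMap S (Localization.AtPrime Q)) hfQ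
  rwa [Ideal.map_pow, Localization.AtPrime.map_eq_maximalIdeal] at this

/-! ## The core lemma (Krull dimension ≤ 2) -/

/-- **Core lemma.** Let `S` be a regular local ring of Krull dimension `≤ 2`, `0 ≠ f ∈ 𝔭` for a prime `𝔭 ≠ 𝔪`, and
suppose the order of `f` does NOT drop at `𝔭`: `iotaOrd (S_𝔭) f = iotaOrd S f`. Then `f = v·gⁿ` with `v` a unit,
`g ∈ 𝔪 ∖ 𝔪²` a regular parameter, `n ≥ 1`, and `𝔭 = (g)`. (UFD: `𝔭` has height one, so `𝔭 = (q)` for a prime element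
`q`; `f = qᵐ h`, `q ∤ h`; `ord_{S_𝔭} f = m` while `ord_𝔪 f = m·ord q + ord h`.)
[cite: Matsumura1987, Thm. 20.3; ZariskiSamuel1960, Ch. VIII §1 Thm. 1] -/
theorem exists_eq_unit_mul_pow_of_iotaOrd_localization_eq [IsRegularLocalRing S] (hdim : ringKrullDim S ≤ 2)
    {f : S} (hf0 : f ≠ 0) (𝔭 : Ideal S) [𝔭.IsPrime] (hf𝔭 : f ∈ 𝔭) (h𝔭 : 𝔭 ≠ maximalIdeal S)
    (heq : iotaOrd (Localization.AtPrime 𝔭) (algebraMap S (Localization.AtPrime 𝔭) f) = iotaOrd S f) :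
    ∃ (v g : S) (n : ℕ), IsUnit v ∧ g ∈ maximalIdeal S ∧ g ∉ maximalIdeal S ^ 2 ∧ 0 < n ∧ f = v * g ^ n ∧
      𝔭 = Ideal.span {g} := by
  classical
  haveI := isDomain_of_isRegularLocalRing S
  haveI : UniqueFactorizationMonoid S := IsRegularLocalRing.uniqueFactorizationMonoid S
  haveI : IsRegularLocalRing (Localization.AtPrime 𝔭) := isRegularLocalRing_localization_atPrime S 𝔭
  -- `𝔭` is a height-one prime, generated by a prime element `q`
  have h𝔭bot : 𝔭 ≠ ⊥ := fun h => hf0 (Ideal.mem_bot.mp (h ▸ hf𝔭))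
  obtain ⟨q, hq𝔭, hq⟩ := Ideal.IsPrime.exists_mem_prime_of_ne_bot ‹_› h𝔭bot
  have hlt : 𝔭 < maximalIdeal S := lt_of_le_of_ne (IsLocalRing.le_maximalIdeal Ideal.IsPrime.ne_top') h𝔭
  have hheight : 𝔭.height = 1 := by
    have h1 : 𝔭.height < (maximalIdeal S).height := Ideal.height_strict_mono_of_isPrime_of_isPrime hlt
    have h2 : ((maximalIdeal S).height : WithBot ℕ∞) ≤ 2 := by
      rw [IsLocalRing.maximalIdeal_height_eq_ringKrullDim]
      exact hdim
    have h2' : (maximalIdeal S).height ≤ 2 := by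
      rw [← WithBot.coe_le_coe, WithBot.coe_ofNat]
      exact h2
    have h3 : 𝔭.height ≠ 0 := by
      rw [Ne, Ideal.height_eq_zero_iff_eq_bot]
      exact h𝔭bot
    have hlt2 : 𝔭.height < 2 := lt_of_lt_of_le h1 h2'
    obtain ⟨k, hk⟩ := ENat.ne_top_iff_exists.mp (ne_top_of_lt hlt2)
    rw [← hk] at hlt2 h3 ⊢
    norm_cast at hlt2 h3 ⊢
    omega
  have h𝔭eq : 𝔭 = Ideal.span {q} := Ideal.eq_span_singleton_of_height_eq_one hheight hq𝔭 hq
  have hq𝔪 : q ∈ maximalIdeal S := hlt.le hq𝔭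
  -- factor `f = qᵐ · h` with `q ∤ h`
  obtain ⟨m, h, hndvd, hfac⟩ := WfDvdMonoid.max_power_factor hf0 hq.irreducible
  have hh0 : h ≠ 0 := by
    rintro rfl
    exact hf0 (by rw [hfac, mul_zero])
  have hh𝔭 : h ∉ 𝔭 := fun hh => hndvd (Ideal.mem_span_singleton.mp (h𝔭eq ▸ hh))
  -- the order at `𝔭`: `ord_{S_𝔭}(q) = 1`, `h` a unit, so `ord_{S_𝔭} f = m`
  have hunit : IsUnit (algebraMap S (Localization.AtPrime 𝔭) h) :=
    IsLocalization.map_units (Localization.AtPrime 𝔭) (⟨h, hh𝔭⟩ : 𝔭.primeCompl)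
  have hq1 : adicOrder (algebraMap S (Localization.AtPrime 𝔭) q) = 1 := by
    apply adicOrder_eq_one_of_not_mem_sq
    · exact (IsLocalization.AtPrime.to_map_mem_maximal_iff (Localization.AtPrime 𝔭) 𝔭 q).mpr hq𝔭
    · intro hmem
      rw [← Localization.AtPrime.map_eq_maximalIdeal, ← Ideal.map_pow,
        IsLocalization.algebraMap_mem_map_algebraMap_iff (M := 𝔭.primeCompl)
          (S := Localization.AtPrime 𝔭)] at hmem
      obtain ⟨s, hs, hsq⟩ := hmem
      rw [h𝔭eq, Ideal.span_singleton_pow, Ideal.mem_span_singleton] at hsq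
      obtain ⟨c, hc⟩ := hsq
      have hsc : s = q * c := by
        apply mul_right_cancel₀ hq.ne_zero
        rw [hc]
        ring
      exact hs (h𝔭eq ▸ Ideal.mem_span_singleton.mpr ⟨c, hsc⟩)
  have hordp : iotaOrd (Localization.AtPrime 𝔭) (algebraMap S (Localization.AtPrime 𝔭) f) = m := by
    rw [hfac, map_mul, map_pow, iotaOrd_eq_ordOfENat_adicOrder, ← ordOfENat_natCast, ordOfENat_inj,
      adicOrder_mul, adicOrder_pow, hq1, adicOrder_of_isUnit hunit, mul_one, add_zero]
  -- the order at `𝔪`: `ord f = m · ord q + ord h`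
  have hord : iotaOrd S f = ordOfENat (m * adicOrder q + adicOrder h) := by
    rw [iotaOrd_eq_ordOfENat_adicOrder, hfac, adicOrder_mul, adicOrder_pow]
  rw [hordp, hord, ← ordOfENat_natCast, ordOfENat_inj] at heq
  obtain ⟨a, ha⟩ := ENat.ne_top_iff_exists.mp (adicOrder_ne_top hq.ne_zero)
  obtain ⟨b, hb⟩ := ENat.ne_top_iff_exists.mp (adicOrder_ne_top hh0)
  have ha1 : 1 ≤ a := by
    have : ((1 : ℕ) : ℕ∞) ≤ adicOrder q := (le_adicOrder_iff q 1).mpr (by rwa [pow_one])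
    rw [← ha] at this
    exact_mod_cast this
  have hm1 : 1 ≤ m := by
    rcases Nat.eq_zero_or_pos m with hm | hm
    · exfalso
      apply hndvd
      have hqf : q ∣ f := Ideal.mem_span_singleton.mp (h𝔭eq ▸ hf𝔭)
      rwa [hfac, hm, pow_zero, one_mul] at hqf
    · exact hm
  rw [← ha, ← hb] at heq
  have heq' : m = m * a + b := by exact_mod_cast heq
  have hma : m ≤ m * a := Nat.le_mul_of_pos_right m ha1
  have hb0 : b = 0 := by omega
  have hma' : m * a = m := by omega
  have ha' : a = 1 := (mul_eq_left₀ (by omega : m ≠ 0)).mp hma'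
  -- conclusion: `q ∉ 𝔪²`, `h` is a unit
  have hq2 : q ∉ maximalIdeal S ^ 2 := by
    rw [← adicOrder_le_iff q 1, ← ha, ha']
  have hhu : IsUnit h := by
    by_contra hnu
    have hh𝔪 : h ∈ maximalIdeal S := (IsLocalRing.mem_maximalIdeal h).mpr (mem_nonunits_iff.mpr hnu)
    have : ((1 : ℕ) : ℕ∞) ≤ adicOrder h := (le_adicOrder_iff h 1).mpr (by rwa [pow_one])
    rw [← hb, hb0] at this
    exact absurd (by exact_mod_cast this : (1 : ℕ) ≤ 0) (by omega)
  exact ⟨h, q, m, hhu, hq𝔪, hq2, hm1, by rw [hfac, mul_comm], h𝔭eq⟩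

/-! ## CASE B (Krull dimension ≤ 2): no pure-power form, centre `𝔪` -/

/-- **CASE B of (strat) for the order function, Krull dimension ≤ 2.** If `0 ≠ f ∈ 𝔪` is NOT of the form `v·gⁿ`
(`v` unit, `g ∈ 𝔪 ∖ 𝔪²`), then `P = 𝔪` satisfies (strat) for `iotaOrd`: `S ⧸ 𝔪` is a field (regular), and for a prime
`𝔭 ∋ f` the order keeps its value iff `𝔭 = 𝔪` (the core lemma; at `𝔭 = 𝔪`, `S ≃ S_𝔪` by (c6)). [OURS · L1 W4.3, kernel] -/
theorem strat_maximalIdeal_of_forall_ne [IsRegularLocalRing S] (hdim : ringKrullDim S ≤ 2) {f : S} (hf0 : f ≠ 0)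
    (hf : f ∈ maximalIdeal S)
    (hB : ∀ (v g : S) (n : ℕ), IsUnit v → g ∈ maximalIdeal S → g ∉ maximalIdeal S ^ 2 → f ≠ v * g ^ n) :
    (maximalIdeal S).IsPrime ∧ IsRegularLocalRing (S ⧸ maximalIdeal S) ∧ f ∈ maximalIdeal S ∧
      ∀ (𝔭 : Ideal S) [𝔭.IsPrime], f ∈ 𝔭 →
        (iotaOrd (Localization.AtPrime 𝔭) (algebraMap S (Localization.AtPrime 𝔭) f) = iotaOrd S f ↔
          maximalIdeal S ≤ 𝔭) := by
  refine ⟨inferInstance, ?_, hf, fun 𝔭 _ hf𝔭 => ⟨fun heq => ?_, fun hle => ?_⟩⟩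
  · -- `S ⧸ 𝔪` is a field, hence regular
    have hF : IsField (S ⧸ maximalIdeal S) :=
      (Ideal.Quotient.maximal_ideal_iff_isField_quotient (maximalIdeal S)).mp inferInstance
    letI := hF.toField
    infer_instance
  · by_contra hne
    have h𝔭 : 𝔭 ≠ maximalIdeal S := fun h => hne (h ▸ le_rfl)
    obtain ⟨v, g, n, hv, hg, hg2, -, hfe, -⟩ :=
      exists_eq_unit_mul_pow_of_iotaOrd_localization_eq hdim hf0 𝔭 hf𝔭 h𝔭 heq
    exact hB v g n hv hg hg2 hfe
  · have h𝔭 : maximalIdeal S = 𝔭 := (IsLocalRing.maximalIdeal.isMaximal S).eq_of_le Ideal.IsPrime.ne_top' hle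
    subst h𝔭
    exact iotaOrd_localization_maximalIdeal_eq f

/-- In case B the (strat) prime IS `𝔪`: any prime `P ∋ f` satisfying (strat) for `iotaOrd` equals `𝔪`.
[OURS · L1 W4.3, kernel] -/
theorem strat_prime_eq_maximalIdeal [IsRegularLocalRing S] (hdim : ringKrullDim S ≤ 2) {f : S} (hf0 : f ≠ 0)
    (hf : f ∈ maximalIdeal S)
    (hB : ∀ (v g : S) (n : ℕ), IsUnit v → g ∈ maximalIdeal S → g ∉ maximalIdeal S ^ 2 → f ≠ v * g ^ n)
    {P : Ideal S} [P.IsPrime] (hfP : f ∈ P)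
    (h : ∀ (𝔭 : Ideal S) [𝔭.IsPrime], f ∈ 𝔭 →
      (iotaOrd (Localization.AtPrime 𝔭) (algebraMap S (Localization.AtPrime 𝔭) f) = iotaOrd S f ↔ P ≤ 𝔭)) :
    P = maximalIdeal S := by
  obtain ⟨-, -, -, hstrat⟩ := strat_maximalIdeal_of_forall_ne hdim hf0 hf hB
  exact strat_prime_unique iotaOrd hfP hf h hstrat

/-- (adm) for the centre `𝔪` of case B: `f ∈ 𝔪²` gives `f ∈ 𝔪_{S_Q}²` at every prime `Q ⊇ 𝔪` (i.e. `Q = 𝔪`).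
[folklore] -/
theorem adm_maximalIdeal [IsLocalRing S] {f : S} (hf2 : f ∈ maximalIdeal S ^ 2) (Q : Ideal S) [Q.IsPrime]
    (hQ : maximalIdeal S ≤ Q) :
    algebraMap S (Localization.AtPrime Q) f ∈ maximalIdeal (Localization.AtPrime Q) ^ 2 := by
  have hfQ : f ∈ Q ^ 2 := Ideal.pow_right_mono hQ 2 hf2
  have := Ideal.mem_map_of_mem (algebraMap S (Localization.AtPrime Q)) hfQ
  rwa [Ideal.map_pow, Localization.AtPrime.map_eq_maximalIdeal] at this

/-! ## Assembly: (strat) for `iotaOrd` at every position of Krull dimension ≤ 2 -/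

/-- **The (strat) conjunct of `CanonicalGameClause` for `ι = iotaOrd`, at every regular local ring of Krull dimension
`≤ 2`** (no ground field, no e.f.t. hypothesis, every characteristic): for `0 ≠ f ∈ 𝔪` there is a prime `P ∋ f` with
`S ⧸ P` regular such that for every prime `𝔭 ∋ f`, `iotaOrd (S_𝔭) f = iotaOrd S f ↔ P ≤ 𝔭` — namely `P = (g)` if
`f = v·gⁿ` with `g` a regular parameter (case A, top-order stratum `V(g)`), else `P = 𝔪` (case B, the closed point).
SHARP in the dimension: at the dimension-3 position `(k[x,y,z]_(x,y,z), z² + x³y³)` no such `P` exists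
(`StratSpecimen.not_strat`, `Theorems/WeightedInvariantIotaOrderNotCanonical.lean`, p506015). This is the ι-half of
res-L1-w43-plan-1's CRUX-PLAN §v7.2 RUNG P2 design «(strat) HOLDS for the order function at dim-2 positions».
[OURS · L1 W4.3, kernel] -/
theorem strat_iotaOrd_of_ringKrullDim_le_two [IsRegularLocalRing S] (hdim : ringKrullDim S ≤ 2) {f : S}
    (hf0 : f ≠ 0) (hf : f ∈ maximalIdeal S) :
    ∃ P : Ideal S, P.IsPrime ∧ IsRegularLocalRing (S ⧸ P) ∧ f ∈ P ∧
      ∀ (𝔭 : Ideal S) [𝔭.IsPrime], f ∈ 𝔭 →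
        (iotaOrd (Localization.AtPrime 𝔭) (algebraMap S (Localization.AtPrime 𝔭) f) = iotaOrd S f ↔ P ≤ 𝔭) := by
  by_cases hA : ∃ (v g : S) (n : ℕ), IsUnit v ∧ g ∈ maximalIdeal S ∧ g ∉ maximalIdeal S ^ 2 ∧ f = v * g ^ n
  · obtain ⟨v, g, n, hv, hg, hg2, hfe⟩ := hA
    have hn : 0 < n := by
      rcases Nat.eq_zero_or_pos n with h | h
      · exfalso
        rw [h, pow_zero, mul_one] at hfe
        rw [hfe] at hf
        exact (mem_nonunits_iff.mp ((IsLocalRing.mem_maximalIdeal v).mp hf)) hv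
      · exact h
    obtain ⟨h1, h2, h3, h4⟩ := strat_of_eq_unit_mul_pow hv hg hg2 hn hfe
    exact ⟨Ideal.span {g}, h1, h2, h3, fun 𝔭 _ hf𝔭 => h4 𝔭 hf𝔭⟩
  · push Not at hA
    obtain ⟨h1, h2, h3, h4⟩ := strat_maximalIdeal_of_forall_ne hdim hf0 hf hA
    exact ⟨maximalIdeal S, h1, h2, h3, fun 𝔭 _ hf𝔭 => h4 𝔭 hf𝔭⟩

/-- The same with the game's hypothesis `f ∈ 𝔪²` (a position of `CanonicalGameClause`) and the (adm) conjunct bundled: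
`∃ P`, (strat) for `iotaOrd` AND `f ∈ 𝔪_{S_Q}²` at every prime `Q ⊇ P`. [OURS · L1 W4.3, kernel] -/
theorem strat_adm_iotaOrd_of_ringKrullDim_le_two [IsRegularLocalRing S] (hdim : ringKrullDim S ≤ 2) {f : S}
    (hf0 : f ≠ 0) (hf2 : f ∈ maximalIdeal S ^ 2) :
    ∃ P : Ideal S, P.IsPrime ∧ IsRegularLocalRing (S ⧸ P) ∧ f ∈ P ∧
      (∀ (𝔭 : Ideal S) [𝔭.IsPrime], f ∈ 𝔭 →
        (iotaOrd (Localization.AtPrime 𝔭) (algebraMap S (Localization.AtPrime 𝔭) f) = iotaOrd S f ↔ P ≤ 𝔭)) ∧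
      ∀ (Q : Ideal S) [Q.IsPrime], P ≤ Q →
        algebraMap S (Localization.AtPrime Q) f ∈ maximalIdeal (Localization.AtPrime Q) ^ 2 := by
  have hf : f ∈ maximalIdeal S := Ideal.pow_le_self two_ne_zero hf2
  by_cases hA : ∃ (v g : S) (n : ℕ), IsUnit v ∧ g ∈ maximalIdeal S ∧ g ∉ maximalIdeal S ^ 2 ∧ f = v * g ^ n
  · obtain ⟨v, g, n, hv, hg, hg2, hfe⟩ := hA
    have hn2 : 2 ≤ n := two_le_of_eq_unit_mul_pow_of_mem_sq hv hg hg2 hfe hf2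
    obtain ⟨h1, h2, h3, h4⟩ := strat_of_eq_unit_mul_pow hv hg hg2 (lt_of_lt_of_le Nat.zero_lt_two hn2) hfe
    exact ⟨Ideal.span {g}, h1, h2, h3, fun 𝔭 _ hf𝔭 => h4 𝔭 hf𝔭, fun Q _ hQ => adm_span_singleton hn2 hfe Q hQ⟩
  · push Not at hA
    obtain ⟨h1, h2, h3, h4⟩ := strat_maximalIdeal_of_forall_ne hdim hf0 hf hA
    exact ⟨maximalIdeal S, h1, h2, h3, fun 𝔭 _ hf𝔭 => h4 𝔭 hf𝔭, fun Q _ hQ => adm_maximalIdeal hf2 Q hQ⟩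

end IotaOrderStrat

end Summit.ResolutionOfSingularities.ResolutionOfSingularities.Cruxes.HypersurfaceCentreConstruction.LocalEngine

end
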